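import Summits.RiemannHypothesis.RiemannHypothesis.Theorems.HandoffLoadCeiling
import Summits.RiemannHypothesis.RiemannHypothesis.Theorems.HandoffDecomposition
import HarnessLib

/-!
# HANDOFF — the CAPACITY of a place: the semi-local wall is the unit level set of a Birman–Schwinger quotient (cell rh-explicit, TRACK «HANDOFF», seat theory-2 gen5, file XII-h)

HONEST FRAMING. Nothing here bears on the truth of RH. The cell's wall-offset law (C-I(b): `δ*(q)·w_q = 1/ρ′(q)`, weil-9 T17 §21 /
conj-1 MARGIN-LAW §3B / SEMILOCAL-TABLE §1b (vi)) rests on a MECHANISM stated on paper and checked on sections («the crossing condition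
`w_P·ρ_b(δ*) = 1`», the Birman–Schwinger pencil of the full form against the atom of the deleted prime). This file TYPES the exact,
`N = ∞`, RH-free form of that mechanism for EVERY finite place set and sector, so that PROVABLE-NOW T1 can say what is PROVED:

* §1 `placeGain p g := −Re W_{{p}}(g ⋆ g̃)` (the energy the place `p` contributes at `g`; on the handoff window it IS prove-2's
  `contribution q g`, `placeGain_eq_contribution`) and the **capacity** `bsCapacity S p P b := sup { placeGain p g / Re Q_{S ∪ {p}}(g) :
  g ∈ C(b)^P, ‖g‖₂ = 1 }` — the largest FRACTION of its `S ∪ {p}`-energy that a test function on the window gets from the place `p` alone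
  (a generalised Rayleigh quotient; DEFINITION ONLY, a real `sSup`, meaningful when the `S ∪ {p}`-form is positive definite on `C(b)^P`).
* §2 Under the single hypothesis `0 < λ' := λ_min(S ∪ {p}; b; P)` (RH-free INPUT: a certified positivity of the larger form; on the
  handoff window `λ' = ε(b)`, the A1 ladder's object): the capacity is finite (`≤ 2Σ_{n ≤ e^{2b}} Λ(n)/√n / λ'`), every ratio is `≤ ρ`,
  **`λ_min(S; b; P) ≥ (1 − ρ)·λ'` when `ρ ≤ 1`** (`semilocalGroundEnergy_ge_of_bsCapacity_le_one`) and **`λ_min(S; b; P) < 0` when `ρ > 1`**,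
  hence **`0 ≤ λ_min(S; b; P) ↔ bsCapacity S p P b ≤ 1`**: deleting the place `p` from a positive form produces a negative direction on
  `C(b)` EXACTLY when some test function draws more than its whole energy from `p`.
* §3 THE WALL IS THE UNIT LEVEL SET: for the all-test sector and `0 < λ_min(S ∪ {p}; b)`, **`b ≤ a*(S) ↔ ρ ≤ 1`** and **`a*(S) < b ↔ 1 < ρ`**
  (`le_weilSemilocalThreshold_iff_bsCapacity_le_one`); for consecutive primes `q < q'` on the window `b ≤ (log q')/2` (where `S_{q'} = S_q ∪ {q}`
  and `λ' = ε(b)`): the capacity of `q` relative to Weil's full form decides the A4 wall, `0 < D_q(b) ↔ 1 < ρ_q(b)`, with the RH-free ceiling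
  `ρ_q(b) ≤ cap(q)/ε(b)` — T17's «crossing condition» as a kernel equivalence at `N = ∞`. The LAW (δ*·w_q·ρ′ = 1) is its LINEARISATION in
  `δ = b − (log q)/2` with a fitted/derived slope `ρ′` — MODEL/DERIVED, not typed here; the MARGIN-IDENTITY-TEST of 2026-08-23 measures exactly
  the gap between this identity and its linearisation.

References (as printed): M. Sh. Birman / J. Schwinger (1961) — the principle, [folklore] here (a sup of a generalised Rayleigh quotient, no operator
theory is used); E. Bombieri, Rend. Mat. Acc. Lincei (9) 11 (2000) §4 Problem 2, Lemma 3 [`Bombieri2000Weil`]; A. Connes, C. Consani, Enseign. Math. 69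
(2023) = arXiv:2106.01715 §2.2–2.4 (smallest eigenvalue with and without a prime) [`ConnesConsani2023`]; H. Yoshida, Adv. Stud. Pure Math. 21 (1992)
Prop. 6 p. 320 (thresholds) [`Yoshida1992HermitianForms`]. The capacity object is this cell's (T17 §21), not in print.
-/

set_option linter.dupNamespace false  -- the mandated namespace repeats `RiemannHypothesis`

noncomputable section
open Set Complex MeasureTheory Literature.NumberTheory.LFunctions
open Summit.RiemannHypothesis.RiemannHypothesis.Theorems.Handoff
open Summit.RiemannHypothesis.RiemannHypothesis.Theorems.HandoffAnalytic
open Summit.RiemannHypothesis.RiemannHypothesis.Theorems.HandoffSemilocalEnergy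
open Summit.RiemannHypothesis.RiemannHypothesis.Theorems.MotivicDoor.SemilocalThreshold
open Summit.RiemannHypothesis.RiemannHypothesis.Theorems.MotivicDoor.Semilocal
open scoped Real ComplexConjugate ArithmeticFunction.vonMangoldt

namespace Summit.RiemannHypothesis.RiemannHypothesis.Theorems.HandoffCapacity

variable {g : ℝ → ℂ} {S : Finset ℕ} {P : (ℝ → ℂ) → Prop} {a b r : ℝ} {p q q' : ℕ}

/-! ## §1 The objects -/

/-- **The gain of the place `p` at `g`**: `−Re W_{{p}}(g ⋆ g̃)` (all powers of `p`) — the amount by which inserting the place `p`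
RAISES the semi-local energy of `g` (`Re Q_S(g) = Re Q_{S ∪ {p}}(g) − placeGain p g`, `re_weilSemilocalQuadratic_eq_sub_placeGain`); on the
handoff window it is prove-2's `contribution q g` (`placeGain_eq_contribution`). [cite: ConnesConsani2023, §2.1 (W_p) and §2.2–2.3 (the contribution of a prime)] -/
def placeGain (p : ℕ) (g : ℝ → ℂ) : ℝ :=
  -(weilSemilocalPrimeTerm {p} (weilConv g (weilReflect g))).re

/-- The set of capacity ratios `placeGain p g / Re Q_{S ∪ {p}}(g)` over the `L²`-unit sphere of `C(b)^P`. [folklore] -/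
def capacitySet (S : Finset ℕ) (p : ℕ) (P : (ℝ → ℂ) → Prop) (b : ℝ) : Set ℝ :=
  {r : ℝ | ∃ g : ℝ → ℂ, IsWeilTest g ∧ tsupport g ⊆ Icc (-b) b ∧ P g ∧ ∫ t : ℝ, ‖g t‖ ^ 2 = 1 ∧
    r = placeGain p g / (weilSemilocalQuadratic (insert p S) g).re}

/-- **The (Birman–Schwinger) capacity of the place `p` relative to `S ∪ {p}` on `C(b)^P`**:
`ρ(S, p; b; P) := sup { placeGain p g / Re Q_{S ∪ {p}}(g) : g ∈ C(b), P g, ‖g‖₂ = 1 }`. DEFINITION ONLY (a real `sSup`; junk `0` for an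
empty or unbounded ratio set; meaningful under `0 < λ_min(S ∪ {p}; b; P)`, §2). [folklore] -/
def bsCapacity (S : Finset ℕ) (p : ℕ) (P : (ℝ → ℂ) → Prop) (b : ℝ) : ℝ :=
  sSup (capacitySet S p P b)

/-- **Additivity read as a gain**: `Re Q_S(g) = Re Q_{S ∪ {p}}(g) − placeGain p g` for `p` prime, `p ∉ S`. [cite: ConnesConsani2023, §2.1.2 (ψ = … − Σ_p W_p)] -/
theorem re_weilSemilocalQuadratic_eq_sub_placeGain (hp : p.Prime) (hpS : p ∉ S) (hg : IsWeilTest g) :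
    (weilSemilocalQuadratic S g).re = (weilSemilocalQuadratic (insert p S) g).re - placeGain p g := by
  rw [re_weilSemilocalQuadratic_insert hp hpS hg, placeGain]
  ring

/-- On the handoff window (`t ≤ log q`) the gain of `q` IS prove-2's contribution of `q`. [folklore] -/
theorem placeGain_eq_contribution (hq : q.Prime) (hg : IsWeilTest g) {t : ℝ} (ht : t ≤ Real.log q)
    (hsupp : tsupport g ⊆ Icc (-t) t) : placeGain q g = contribution q g := by
  rw [placeGain, HandoffDecomposition.contribution_eq_place hq hg ht hsupp]

/-- **A-priori bound on the gain**: `|placeGain p g| ≤ 2(Σ_{n ≤ e^{2b}} Λ(n)/√n)·‖g‖₂²` for `g ∈ C(b)` (Bombieri's `|g ⋆ g̃| ≤ ‖g‖₂²` and the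
finite prime sum on the window). [cite: Bombieri2000Weil, §4 Lemma 2 and Lemma 3] -/
theorem abs_placeGain_le (p : ℕ) (hg : IsWeilTest g) (hsupp : tsupport g ⊆ Icc (-b) b) :
    |placeGain p g| ≤ 2 * (∑ n ∈ Finset.range (⌊Real.exp (2 * b)⌋₊ + 1), (Λ n : ℝ) / Real.sqrt n) *
      ∫ t, ‖g t‖ ^ 2 := by
  have hk : IsWeilTest (weilConv g (weilReflect g)) := hg.weilConv hg.weilReflect
  have h := norm_weilSemilocalPrimeTerm_le_of_tsupport_subset {p} hk.1.continuous
    (tsupport_weilConv_weilReflect_subset hg.2 hsupp) (norm_weilConv_weilReflect_le hg)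
  rw [placeGain, abs_neg]
  calc |(weilSemilocalPrimeTerm {p} (weilConv g (weilReflect g))).re|
      ≤ ‖weilSemilocalPrimeTerm {p} (weilConv g (weilReflect g))‖ := Complex.abs_re_le_norm _
    _ ≤ 2 * (∫ t, ‖g t‖ ^ 2) * ∑ n ∈ Finset.range (⌊Real.exp (2 * b)⌋₊ + 1), (Λ n : ℝ) / Real.sqrt n := h
    _ = _ := by ring

/-! ## §2 The capacity criterion under `0 < λ_min(S ∪ {p}; b; P)` -/

/-- The ratio set is indexed by the same test functions as the sphere: nonempty together. [folklore] -/
theorem capacitySet_nonempty_iff : (capacitySet S p P b).Nonempty ↔ (semilocalSphereValues S P b).Nonempty := by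
  constructor
  · rintro ⟨r, g, hg, hs, hP, hn, -⟩
    exact ⟨_, g, hg, hs, hP, hn, rfl⟩
  · rintro ⟨x, g, hg, hs, hP, hn, -⟩
    exact ⟨_, g, hg, hs, hP, hn, rfl⟩

/-- **The capacity is finite**: under `0 < λ' = λ_min(S ∪ {p}; b; P)` every ratio is `≤ 2(Σ_{n ≤ e^{2b}} Λ(n)/√n)/λ'`. [folklore] -/
theorem capacitySet_bddAbove (hpos : 0 < semilocalGroundEnergy (insert p S) P b) :
    BddAbove (capacitySet S p P b) := by
  set C : ℝ := 2 * (∑ n ∈ Finset.range (⌊Real.exp (2 * b)⌋₊ + 1), (Λ n : ℝ) / Real.sqrt n) with hC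
  have hC0 : 0 ≤ C := mul_nonneg zero_le_two (Finset.sum_nonneg fun n _ ↦
    div_nonneg ArithmeticFunction.vonMangoldt_nonneg (Real.sqrt_nonneg _))
  refine ⟨C / semilocalGroundEnergy (insert p S) P b, ?_⟩
  rintro r ⟨g, hg, hs, hP, hn, rfl⟩
  have hQ : semilocalGroundEnergy (insert p S) P b ≤ (weilSemilocalQuadratic (insert p S) g).re :=
    semilocalGroundEnergy_le_re hg hs hP hn
  have hQpos : 0 < (weilSemilocalQuadratic (insert p S) g).re := hpos.trans_le hQ
  have hG : |placeGain p g| ≤ C := by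
    have := abs_placeGain_le p hg hs
    rwa [hn, mul_one] at this
  calc placeGain p g / (weilSemilocalQuadratic (insert p S) g).re
      ≤ C / (weilSemilocalQuadratic (insert p S) g).re :=
        div_le_div_of_nonneg_right ((le_abs_self _).trans hG) hQpos.le
    _ ≤ C / semilocalGroundEnergy (insert p S) P b := div_le_div_of_nonneg_left hC0 hpos hQ

/-- Every sphere element's ratio is at most the capacity. [folklore] -/
theorem div_le_bsCapacity (hpos : 0 < semilocalGroundEnergy (insert p S) P b) (hg : IsWeilTest g)
    (hs : tsupport g ⊆ Icc (-b) b) (hP : P g) (hn : ∫ t : ℝ, ‖g t‖ ^ 2 = 1) :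
    placeGain p g / (weilSemilocalQuadratic (insert p S) g).re ≤ bsCapacity S p P b :=
  le_csSup (capacitySet_bddAbove hpos) ⟨g, hg, hs, hP, hn, rfl⟩

/-- On the sphere the gain is at most `ρ · Re Q_{S ∪ {p}}(g)`. [folklore] -/
theorem placeGain_le_bsCapacity_mul (hpos : 0 < semilocalGroundEnergy (insert p S) P b) (hg : IsWeilTest g)
    (hs : tsupport g ⊆ Icc (-b) b) (hP : P g) (hn : ∫ t : ℝ, ‖g t‖ ^ 2 = 1) :
    placeGain p g ≤ bsCapacity S p P b * (weilSemilocalQuadratic (insert p S) g).re := by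
  have hQpos : 0 < (weilSemilocalQuadratic (insert p S) g).re :=
    hpos.trans_le (semilocalGroundEnergy_le_re hg hs hP hn)
  exact (div_le_iff₀ hQpos).1 (div_le_bsCapacity hpos hg hs hP hn)

/-- **Capacity ≤ 1 ⟹ the smaller form stays non-negative, quantitatively**: `(1 − ρ)·λ_min(S ∪ {p}; b; P) ≤ λ_min(S; b; P)` when
`ρ = bsCapacity S p P b ≤ 1` (and `0 < λ_min(S ∪ {p}; b; P)`, `p` prime, `p ∉ S`). [folklore] -/
theorem semilocalGroundEnergy_ge_of_bsCapacity_le_one (hp : p.Prime) (hpS : p ∉ S)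
    (hpos : 0 < semilocalGroundEnergy (insert p S) P b) (hne : (semilocalSphereValues S P b).Nonempty)
    (hρ : bsCapacity S p P b ≤ 1) :
    (1 - bsCapacity S p P b) * semilocalGroundEnergy (insert p S) P b ≤ semilocalGroundEnergy S P b := by
  refine le_semilocalGroundEnergy hne fun g hg hs hP hn ↦ ?_
  have hQ : semilocalGroundEnergy (insert p S) P b ≤ (weilSemilocalQuadratic (insert p S) g).re :=
    semilocalGroundEnergy_le_re hg hs hP hn
  have hG := placeGain_le_bsCapacity_mul hpos hg hs hP hn
  rw [re_weilSemilocalQuadratic_eq_sub_placeGain hp hpS hg]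
  have h1 : 0 ≤ 1 - bsCapacity S p P b := by linarith
  have h2 := mul_le_mul_of_nonneg_left hQ h1
  linarith

/-- In particular `ρ ≤ 1 ⟹ 0 ≤ λ_min(S; b; P)`. [folklore] -/
theorem semilocalGroundEnergy_nonneg_of_bsCapacity_le_one (hp : p.Prime) (hpS : p ∉ S)
    (hpos : 0 < semilocalGroundEnergy (insert p S) P b) (hne : (semilocalSphereValues S P b).Nonempty)
    (hρ : bsCapacity S p P b ≤ 1) : 0 ≤ semilocalGroundEnergy S P b :=
  (mul_nonneg (by linarith) hpos.le).trans (semilocalGroundEnergy_ge_of_bsCapacity_le_one hp hpS hpos hne hρ)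

/-- **Capacity > 1 ⟹ a negative direction**: if `1 < bsCapacity S p P b` then some unit `g ∈ C(b)^P` has `placeGain p g > Re Q_{S ∪ {p}}(g)`,
so `Re Q_S(g) < 0` and `λ_min(S; b; P) < 0`. [folklore] -/
theorem semilocalGroundEnergy_neg_of_one_lt_bsCapacity (hp : p.Prime) (hpS : p ∉ S)
    (hpos : 0 < semilocalGroundEnergy (insert p S) P b) (hne : (semilocalSphereValues S P b).Nonempty)
    (hρ : 1 < bsCapacity S p P b) : semilocalGroundEnergy S P b < 0 := by
  obtain ⟨r, ⟨g, hg, hs, hP, hn, rfl⟩, hr⟩ := exists_lt_of_lt_csSup (capacitySet_nonempty_iff.2 hne) hρ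
  have hQ : semilocalGroundEnergy (insert p S) P b ≤ (weilSemilocalQuadratic (insert p S) g).re :=
    semilocalGroundEnergy_le_re hg hs hP hn
  have hQpos : 0 < (weilSemilocalQuadratic (insert p S) g).re := hpos.trans_le hQ
  have hG : (weilSemilocalQuadratic (insert p S) g).re < placeGain p g := by
    rwa [lt_div_iff₀ hQpos, one_mul] at hr
  have hle : semilocalGroundEnergy S P b ≤ (weilSemilocalQuadratic S g).re := semilocalGroundEnergy_le_re hg hs hP hn
  rw [re_weilSemilocalQuadratic_eq_sub_placeGain hp hpS hg] at hle
  linarith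

/-- **THE CAPACITY CRITERION**: under `0 < λ_min(S ∪ {p}; b; P)`, `0 ≤ λ_min(S; b; P) ↔ bsCapacity S p P b ≤ 1`. [folklore] -/
theorem semilocalGroundEnergy_nonneg_iff_bsCapacity_le_one (hp : p.Prime) (hpS : p ∉ S)
    (hpos : 0 < semilocalGroundEnergy (insert p S) P b) (hne : (semilocalSphereValues S P b).Nonempty) :
    0 ≤ semilocalGroundEnergy S P b ↔ bsCapacity S p P b ≤ 1 := by
  refine ⟨fun h ↦ ?_, semilocalGroundEnergy_nonneg_of_bsCapacity_le_one hp hpS hpos hne⟩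
  by_contra hρ
  exact absurd h (not_le.2 (semilocalGroundEnergy_neg_of_one_lt_bsCapacity hp hpS hpos hne (not_le.1 hρ)))

/-- Equivalently `λ_min(S; b; P) < 0 ↔ 1 < bsCapacity S p P b`. [folklore] -/
theorem semilocalGroundEnergy_neg_iff_one_lt_bsCapacity (hp : p.Prime) (hpS : p ∉ S)
    (hpos : 0 < semilocalGroundEnergy (insert p S) P b) (hne : (semilocalSphereValues S P b).Nonempty) :
    semilocalGroundEnergy S P b < 0 ↔ 1 < bsCapacity S p P b := by
  rw [← not_le, semilocalGroundEnergy_nonneg_iff_bsCapacity_le_one hp hpS hpos hne, not_le]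

/-! ## §3 The wall is the unit level set of the capacity -/

/-- **`b ≤ a*(S) ↔ ρ(S, p; b) ≤ 1`** (all-test sector, `0 < b`, `0 < λ_min(S ∪ {p}; b)`, `p` prime, `p ∉ S`): the semi-local wall of `S` is where the
capacity of the deleted place reaches `1`. [cite: Yoshida1992HermitianForms, Prop. 6 (p. 320), with the primes restricted to S; criterion: this track] -/
theorem le_weilSemilocalThreshold_iff_bsCapacity_le_one (hp : p.Prime) (hpS : p ∉ S) (hb : 0 < b)
    (hpos : 0 < semilocalGroundEnergy (insert p S) (fun _ ↦ True) b) :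
    b ≤ weilSemilocalThreshold S ↔ bsCapacity S p (fun _ ↦ True) b ≤ 1 := by
  rw [← semilocalGroundEnergy_top_nonneg_iff_le_threshold,
    semilocalGroundEnergy_nonneg_iff_bsCapacity_le_one hp hpS hpos (semilocalSphereValues_top_nonempty S hb)]

/-- **`a*(S) < b ↔ 1 < ρ(S, p; b)`** (same hypotheses). [cite: Yoshida1992HermitianForms, Prop. 6 (p. 320), with the primes restricted to S; criterion: this track] -/
theorem weilSemilocalThreshold_lt_iff_one_lt_bsCapacity (hp : p.Prime) (hpS : p ∉ S) (hb : 0 < b)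
    (hpos : 0 < semilocalGroundEnergy (insert p S) (fun _ ↦ True) b) :
    weilSemilocalThreshold S < b ↔ 1 < bsCapacity S p (fun _ ↦ True) b := by
  rw [← not_le, le_weilSemilocalThreshold_iff_bsCapacity_le_one hp hpS hb hpos, not_le]

/-- For consecutive primes `q < q'`: `S_{q'} = S_q ∪ {q}` and `q ∉ S_q`. [folklore] -/
theorem primesBelow_consecutive (h : ConsecutivePrimes q q') :
    Nat.primesBelow q' = insert q (Nat.primesBelow q) ∧ q ∉ Nat.primesBelow q := by
  refine ⟨?_, Nat.notMem_primesBelow q⟩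
  rw [h.primesBelow_eq, Nat.primesBelow_succ, if_pos h.1]

/-- **ON THE HANDOFF WINDOW the reference energy is Weil's `ε(b)`**: for consecutive primes `q < q'` and `b ≤ (log q')/2`,
`λ_min(S_q ∪ {q}; b) = ε(b)` (locality). [folklore] -/
theorem semilocalGroundEnergy_insert_window (h : ConsecutivePrimes q q') (hb : b ≤ Real.log q' / 2) :
    semilocalGroundEnergy (insert q (Nat.primesBelow q)) (fun _ ↦ True) b = weilGroundEnergy b := by
  rw [← (primesBelow_consecutive h).1, semilocalGroundEnergy_window_top h hb]

/-- **THE A4 WALL AS A CAPACITY CROSSING (T17's «crossing condition», exact at `N = ∞`)**: for consecutive primes `q < q'`,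
`0 < b ≤ (log q')/2` and `0 < ε(b)` (the certified ladder input; under RH automatic): `0 < D_q(b) ↔ 1 < ρ_q(b)`, where
`ρ_q(b) = bsCapacity S_q q ⊤ b = sup_{g ∈ C(b)} contribution_q(g)/Re Q(g)` is the largest fraction of its Weil energy a test function
on the window gets back from the place `q`. [cite: ConnesConsani2023, §2.2–2.4 (the wall moves when the prime is added); criterion: this track] -/
theorem aggregateDeficit_pos_iff_one_lt_bsCapacity (h : ConsecutivePrimes q q') (hb0 : 0 < b)
    (hb : b ≤ Real.log q' / 2) (hε : 0 < weilGroundEnergy b) :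
    0 < aggregateDeficit q b ↔ 1 < bsCapacity (Nat.primesBelow q) q (fun _ ↦ True) b := by
  have hpos : 0 < semilocalGroundEnergy (insert q (Nat.primesBelow q)) (fun _ ↦ True) b := by
    rwa [semilocalGroundEnergy_insert_window h hb]
  rw [aggregateDeficit, neg_pos, semilocalGroundEnergy_neg_iff_one_lt_bsCapacity h.1 (primesBelow_consecutive h).2 hpos
    (semilocalSphereValues_top_nonempty _ hb0)]

/-- And the wall itself: `b ≤ a*(S_q) ↔ ρ_q(b) ≤ 1`, `a*(S_q) < b ↔ 1 < ρ_q(b)` on `0 < b ≤ (log q')/2` with `0 < ε(b)`. [cite: Yoshida1992HermitianForms, Prop. 6 (p. 320); criterion: this track] -/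
theorem le_wall_iff_bsCapacity_le_one (h : ConsecutivePrimes q q') (hb0 : 0 < b) (hb : b ≤ Real.log q' / 2)
    (hε : 0 < weilGroundEnergy b) :
    b ≤ weilSemilocalThreshold (Nat.primesBelow q) ↔ bsCapacity (Nat.primesBelow q) q (fun _ ↦ True) b ≤ 1 := by
  have hpos : 0 < semilocalGroundEnergy (insert q (Nat.primesBelow q)) (fun _ ↦ True) b := by
    rwa [semilocalGroundEnergy_insert_window h hb]
  exact le_weilSemilocalThreshold_iff_bsCapacity_le_one h.1 (primesBelow_consecutive h).2 hb0 hpos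

/-- **Quantitative form on the window**: if `ρ_q(b) ≤ 1` then `D_q(b) ≤ (ρ_q(b) − 1)·ε(b) ≤ 0` — the old form keeps the fraction `1 − ρ` of
Weil's ground energy. [folklore] -/
theorem aggregateDeficit_le_of_bsCapacity_le_one (h : ConsecutivePrimes q q') (hb0 : 0 < b) (hb : b ≤ Real.log q' / 2)
    (hε : 0 < weilGroundEnergy b) (hρ : bsCapacity (Nat.primesBelow q) q (fun _ ↦ True) b ≤ 1) :
    aggregateDeficit q b ≤ (bsCapacity (Nat.primesBelow q) q (fun _ ↦ True) b - 1) * weilGroundEnergy b := by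
  have hpos : 0 < semilocalGroundEnergy (insert q (Nat.primesBelow q)) (fun _ ↦ True) b := by
    rwa [semilocalGroundEnergy_insert_window h hb]
  have := semilocalGroundEnergy_ge_of_bsCapacity_le_one h.1 (primesBelow_consecutive h).2 hpos
    (semilocalSphereValues_top_nonempty _ hb0) hρ
  rw [semilocalGroundEnergy_insert_window h hb] at this
  unfold aggregateDeficit
  linarith

/-- **RH-free ceiling of the window capacity**: `ρ_q(b) ≤ cap(q)/ε(b)`, `cap(q) = (log q)/√q`, for `0 < b ≤ (log q')/2`, `0 < ε(b)` — every
ratio is `contribution_q(g)/Re Q(g) ≤ cap(q)‖g‖₂²/(ε(b)‖g‖₂²)` (the sharp edge-layer cap). [cite: ConnesConsani2023, §2.2–2.3; sharp cap: this track] -/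
theorem bsCapacity_window_le (h : ConsecutivePrimes q q') (hb0 : 0 < b) (hb : b ≤ Real.log q' / 2)
    (hε : 0 < weilGroundEnergy b) :
    bsCapacity (Nat.primesBelow q) q (fun _ ↦ True) b ≤ Real.log q / Real.sqrt q / weilGroundEnergy b := by
  obtain ⟨hins, hqS⟩ := primesBelow_consecutive h
  have hne : (capacitySet (Nat.primesBelow q) q (fun _ ↦ True) b).Nonempty :=
    capacitySet_nonempty_iff.2 (semilocalSphereValues_top_nonempty _ hb0)
  refine csSup_le hne ?_
  rintro r ⟨g, hg, hs, -, hn, rfl⟩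
  have hblog : b ≤ Real.log q := (hb.trans_lt h.log_half_lt_log).le
  have hb' : b ≤ Real.log (((q' - 1 : ℕ) : ℝ) + 1) / 2 := by rw [h.cast_pred_add_one]; exact hb
  have hfull : (weilSemilocalQuadratic (insert q (Nat.primesBelow q)) g).re = (weilQuadratic g).re := by
    rw [← hins, h.primesBelow_eq, weilSemilocalQuadratic_eq_weilQuadratic_of_forall hg
      (primeFactors_subset_primesBelow_succ_of_gap h.gap) (hs.trans (Icc_subset_Icc (neg_le_neg hb') hb'))]
  have hQ : weilGroundEnergy b ≤ (weilQuadratic g).re := by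
    have := semilocalGroundEnergy_le_re (S := insert q (Nat.primesBelow q)) (P := fun _ ↦ True) hg hs trivial hn
    rwa [semilocalGroundEnergy_insert_window h hb, hfull] at this
  have hQpos : 0 < (weilQuadratic g).re := hε.trans_le hQ
  have hcap : placeGain q g ≤ Real.log q / Real.sqrt q := by
    rw [placeGain_eq_contribution h.1 hg hblog hs]
    have := HandoffEdgeLayer.abs_contribution_le_of_window h hg hb hs
    rw [hn, mul_one] at this
    exact (le_abs_self _).trans this
  have hcap0 : 0 ≤ Real.log q / Real.sqrt q := div_nonneg (Real.log_natCast_nonneg q) (Real.sqrt_nonneg _)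
  rw [hfull, div_le_div_iff₀ hQpos hε]
  have h1 := mul_le_mul_of_nonneg_right hcap hε.le
  have h2 := mul_le_mul_of_nonneg_left hQ hcap0
  linarith

end Summit.RiemannHypothesis.RiemannHypothesis.Theorems.HandoffCapacity
end
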